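import Literature.NumberTheory.Transcendental.RoySmallValueFactorizationK
import Literature.NumberTheory.Transcendental.RoySmallValueOrbitsK
import HarnessLib

/-!
# Roy's small value estimate for `𝔾ₐ × 𝔾ₘ` — descent of the factorisation of `F = Φ(P, Q, ·)` to the number field of a configuration, and conjugation

Topic `Literature/NumberTheory/Transcendental`. Part of the formalisation of the proof of Roy 2013,
Theorem 1.1 (named fact `roy2013_thm_1_1`, `RoySmallValueEstimates.lean`). Source: D. Roy,
*A small value estimate for `𝔾ₐ × 𝔾ₘ`*, Mathematika 59 (2013) 333–363 = arXiv:1301.0663, §6,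
proof of Proposition 6.4 (p. 17 of the arXiv text):

> `F(R) = a R(α₁)^{e₁} ⋯ R(α_t)^{e_t}` [...] Moreover, `e₁ = ⋯ = e_s` represents the multiplicity
> of `G` as an irreducible factor of `F` over `ℚ`.

For integer forms `P, Q` and the normalised system of representatives of `𝒵(P, Q)` with its
number field `K` (`ZeroConfigK`, `RoySmallValueOrbitsK`), we prove that the complex factorisation
`F = c ∏ ℓ_{αᵢ}^{eᵢ}` of `F = royF` (`RoySmallValueFactorization`) DESCENDS to `K`
(`exists_factorisation_fld`: `F = A ∏ ℓ_{aᵢ}^{eᵢ}` in `K[r]` with `A ∈ K` — cf. the tree's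
`exists_descend_factorisation` for an abstract embedded `K` — in exactly the shape
consumed by the Gelfond–Mahler inequality `sum_mul_logHeight_le'` of the tree), and that the
exponents are constant on the orbits of `Aut(K/ℚ)` (`mult_perm`: `e_{g·i} = e_i`, the displayed
"`e₁ = ⋯ = e_s`"), by conjugating the `K`-factorisation and comparing exact multiplicities.
Everything is proved; no definitions (the linear forms `evalFormK` over `K` are the tree's); no
named facts.

## References

* [Roy2013] D. Roy, *A small value estimate for 𝔾ₐ × 𝔾ₘ*, Mathematika 59 (2013), 333–363
  (arXiv:1301.0663), §6, proof of Proposition 6.4, (6.4) and the sentence after it.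
-/

noncomputable section

open MvPolynomial Finset

namespace Literature.NumberTheory.Transcendental

namespace Roy2013

variable {D : ℕ} {M₁ M₂ : Finset (Fin 3 →₀ ℕ)}

/-! ### The linear forms over `K` -/

-- `evalFormK D a = ∑_ν a^ν r_ν` over any commutative semiring, `map_evalFormK` and
-- `evalFormK_eq_evalForm` are the tree's (`RoySmallValueFactorizationK`, seat B).

variable {ι : Type*} [Fintype ι] {K : IntermediateField ℚ ℂ} (Z : ZeroConfigK K ι)

/-- The complexification of `ℓ_{a_i}` is `ℓ_{α_i}`. [folklore] -/
theorem map_evalFormK_rep (i : ι) :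
    map (algebraMap K ℂ) (evalFormK D (Z.rep i)) = evalForm D (Z.α i) := by
  rw [map_evalFormK, ← evalFormK_eq_evalForm]
  congr 1

/-- Conjugating `ℓ_{a_i}` gives `ℓ_{a_{perm g i}}`. [folklore] -/
theorem map_algEquiv_evalFormK_rep (g : K ≃ₐ[ℚ] K) (i : ι) :
    map (g : K →+* K) (evalFormK D (Z.rep i)) = evalFormK D (Z.rep (Z.perm g i)) := by
  rw [map_evalFormK, ← Z.rep_perm g i]
  rfl

/-! ### Descent of the factorisation to `K` -/

/-- Base changing an integer polynomial to `K` and then to `ℂ`. [folklore] -/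
theorem map_map_int {τ : Type*} (F₀ : MvPolynomial τ ℤ) :
    map (algebraMap K ℂ) (map (Int.castRingHom K) F₀) = map (Int.castRingHom ℂ) F₀ := by
  rw [MvPolynomial.map_map,
    RingHom.ext_int ((algebraMap K ℂ).comp (Int.castRingHom K)) (Int.castRingHom ℂ)]

/-- **Descent.** If `map ℂ F₀ = c ∏ ℓ_{αᵢ}^{eᵢ}` for an integer polynomial `F₀` and the
normalised representatives `αᵢ` (with coordinates in `K`), then `map K F₀ = A ∏ ℓ_{aᵢ}^{eᵢ}` in
`K[r]` for some `A ∈ K` mapping to `c`. [cite: Roy2013, §6, proof of Prop. 6.4 (the factorisation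
"over `ℚ`")] -/
theorem exists_factorisation_fld {F₀ : MvPolynomial (CoefIdx D) ℤ} {c : ℂ} {e : ι → ℕ}
    (hfac : map (Int.castRingHom ℂ) F₀ = C c * ∏ i, evalForm D (Z.α i) ^ e i) :
    ∃ A : K, (A : ℂ) = c ∧
      map (Int.castRingHom K) F₀ = C A * ∏ i, evalFormK D (Z.rep i) ^ e i := by
  classical
  set G : MvPolynomial (CoefIdx D) K := ∏ i, evalFormK D (Z.rep i) ^ e i with hG
  have hGmap : map (algebraMap K ℂ) G = ∏ i, evalForm D (Z.α i) ^ e i := by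
    rw [hG, map_prod]
    exact Finset.prod_congr rfl fun i _ => by rw [map_pow, map_evalFormK_rep]
  have hinj : Function.Injective (map (algebraMap K ℂ) :
      MvPolynomial (CoefIdx D) K → MvPolynomial (CoefIdx D) ℂ) :=
    map_injective _ (algebraMap K ℂ).injective
  have hG0 : G ≠ 0 := by
    rw [hG]
    exact Finset.prod_ne_zero_iff.mpr fun i _ => pow_ne_zero _ fun h0 => by
      have h2 := congrArg (map (algebraMap K ℂ)) h0
      rw [map_evalFormK_rep, map_zero] at h2
      exact evalForm_ne_zero (Z.α_ne_zero i) h2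
  obtain ⟨μ, hμ⟩ := MvPolynomial.ne_zero_iff.mp hG0
  set A : K := coeff μ (map (Int.castRingHom K) F₀) / coeff μ G with hA
  have hcμ : coeff μ (map (Int.castRingHom ℂ) F₀) = c * algebraMap K ℂ (coeff μ G) := by
    rw [hfac, ← hGmap, coeff_C_mul, coeff_map]
  have hAc : (A : ℂ) = c := by
    rw [hA]
    change algebraMap K ℂ (coeff μ (map (Int.castRingHom K) F₀) / coeff μ G) = c
    rw [map_div₀, ← coeff_map, map_map_int, hcμ,
      mul_div_cancel_right₀ _ ((map_ne_zero_iff _ (algebraMap K ℂ).injective).mpr hμ)]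
  refine ⟨A, hAc, hinj ?_⟩
  rw [map_map_int, map_mul, map_C, hGmap, hfac]
  change C c * _ = C (algebraMap K ℂ A) * _
  rw [show algebraMap K ℂ A = (A : ℂ) from rfl, hAc]

/-! ### The exponents are constant on orbits -/

/-- Conjugating an integer polynomial over `K` does nothing. [folklore] -/
theorem map_algEquiv_map_int {τ : Type*} (g : K ≃ₐ[ℚ] K) (F₀ : MvPolynomial τ ℤ) :
    map (g : K →+* K) (map (Int.castRingHom K) F₀) = map (Int.castRingHom K) F₀ := by
  rw [MvPolynomial.map_map,
    RingHom.ext_int ((g : K →+* K).comp (Int.castRingHom K)) (Int.castRingHom K)]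

/-- **Conjugating a `K`-factorisation**: from `map K F₀ = A ∏ ℓ_{a_j}^{e_j}` we get, for every
`g ∈ Aut(K/ℚ)`, `map ℂ F₀ = g(A) ∏ ℓ_{α_{perm g j}}^{e_j}`. [cite: Roy2013, §6, proof of Prop. 6.4
("conjugate over `ℚ`")] -/
theorem conj_factorisation {F₀ : MvPolynomial (CoefIdx D) ℤ} {A : K} {e : ι → ℕ}
    (hK : map (Int.castRingHom K) F₀ = C A * ∏ i, evalFormK D (Z.rep i) ^ e i)
    (g : K ≃ₐ[ℚ] K) :
    map (Int.castRingHom ℂ) F₀ =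
      C ((g A : K) : ℂ) * ∏ j, evalForm D (Z.α (Z.perm g j)) ^ e j := by
  have h1 : map (Int.castRingHom K) F₀ =
      C (g A) * ∏ j, evalFormK D (Z.rep (Z.perm g j)) ^ e j := by
    conv_lhs => rw [← map_algEquiv_map_int g F₀, hK]
    rw [map_mul, map_C, map_prod]
    congr 1
    exact Finset.prod_congr rfl fun j _ => by rw [map_pow, map_algEquiv_evalFormK_rep]
  rw [← map_map_int (K := K) F₀, h1, map_mul, map_C, map_prod]
  congr 1
  exact Finset.prod_congr rfl fun j _ => by rw [map_pow, map_evalFormK_rep]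

/-- **`e_{g·i} = eᵢ`**: the exact multiplicities in `F = c ∏ ℓ_{αᵢ}^{eᵢ}` are invariant under the
permutations induced by `Aut(K/ℚ)`. [cite: Roy2013, §6, proof of Prop. 6.4 ("`e₁ = ⋯ = e_s`")] -/
theorem mult_perm {F₀ : MvPolynomial (CoefIdx D) ℤ} {c : ℂ} {e : ι → ℕ}
    (hfac : map (Int.castRingHom ℂ) F₀ = C c * ∏ i, evalForm D (Z.α i) ^ e i)
    (hemax : ∀ i k, evalForm D (Z.α i) ^ k ∣ map (Int.castRingHom ℂ) F₀ → k ≤ e i)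
    (g : K ≃ₐ[ℚ] K) (i : ι) : e (Z.perm g i) = e i := by
  classical
  -- `e i ≤ e (perm g i)` for all `g, i`
  have key : ∀ (g : K ≃ₐ[ℚ] K) (i : ι), e i ≤ e (Z.perm g i) := by
    intro g i
    obtain ⟨A, -, hK⟩ := exists_factorisation_fld Z hfac
    have h2 := conj_factorisation Z hK g
    refine hemax (Z.perm g i) (e i) ⟨C ((g A : K) : ℂ) * ∏ j ∈ univ.erase i,
      evalForm D (Z.α (Z.perm g j)) ^ e j, ?_⟩
    rw [h2, ← Finset.mul_prod_erase univ (fun j => evalForm D (Z.α (Z.perm g j)) ^ e j)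
      (mem_univ i)]
    ring
  refine le_antisymm ?_ (key g i)
  have h := key g⁻¹ (Z.perm g i)
  rwa [← Z.perm_mul, inv_mul_cancel, Z.perm_one] at h

/-- Reindexing a product along `perm g`, using `e_{g·j} = e_j`. [folklore] -/
theorem prod_perm_pow_eq {M : Type*} [CommMonoid M] {F₀ : MvPolynomial (CoefIdx D) ℤ} {c : ℂ}
    {e : ι → ℕ} (hfac : map (Int.castRingHom ℂ) F₀ = C c * ∏ i, evalForm D (Z.α i) ^ e i)
    (hemax : ∀ i k, evalForm D (Z.α i) ^ k ∣ map (Int.castRingHom ℂ) F₀ → k ≤ e i)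
    (g : K ≃ₐ[ℚ] K) (f : ι → M) : ∏ j, f (Z.perm g j) ^ e j = ∏ j, f j ^ e j := by
  have h1 : ∀ j, f (Z.perm g j) ^ e j = f (Z.perm g j) ^ e (Z.perm g j) := fun j => by
    rw [mult_perm Z hfac hemax g j]
  simp_rw [h1]
  exact Equiv.prod_comp (Z.permEquiv g) (fun j => f j ^ e j)

/-- **`σ(A) = c` for every embedding**: the leading constant of the `K`-factorisation is mapped to
the complex leading constant by every automorphism (so it is in fact rational).
[cite: Roy2013, §6, proof of Prop. 6.4 (`a ∈ ℤ`)] -/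
theorem coe_algEquiv_leading_eq {F₀ : MvPolynomial (CoefIdx D) ℤ} {c : ℂ} {A : K} {e : ι → ℕ}
    (hfac : map (Int.castRingHom ℂ) F₀ = C c * ∏ i, evalForm D (Z.α i) ^ e i)
    (hemax : ∀ i k, evalForm D (Z.α i) ^ k ∣ map (Int.castRingHom ℂ) F₀ → k ≤ e i)
    (hK : map (Int.castRingHom K) F₀ = C A * ∏ i, evalFormK D (Z.rep i) ^ e i)
    (g : K ≃ₐ[ℚ] K) : ((g A : K) : ℂ) = c := by
  have h1 := conj_factorisation Z hK g
  rw [prod_perm_pow_eq Z hfac hemax g (fun j => evalForm D (Z.α j)), hfac] at h1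
  have hP : (∏ i, evalForm D (Z.α i) ^ e i) ≠ 0 :=
    Finset.prod_ne_zero_iff.mpr fun i _ => pow_ne_zero _ (evalForm_ne_zero (Z.α_ne_zero i))
  have h2 := mul_right_cancel₀ hP h1
  exact (C_injective _ _ h2).symm

end Roy2013

end Literature.NumberTheory.Transcendental
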